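import Mathlib
import Literature.MathematicalPhysics.QuantumLattice.WilsonDiracAP
import Literature.MathematicalPhysics.QuantumLattice.WilsonPositivityDomain
import Literature.Analysis.Matrix.HadamardInequality
import HarnessLib

/-!
# Heavy-window floor on the antiperiodic Wilson determinant (crux stmt-QuantumFields-9735, line `Sketch`)

Helper toward the lead's stub `stub_signedFloor` of the skeleton
`Cruxes/UnquenchedChessboardBound/Lines/Sketch.lean`: the PATHWISE quantitative form of Seiler's
positivity domain,

* `pow_le_re_fermionDet_wilsonDirac` — for a unitary colour representation, every gauge field on the
  periodic four-torus and every bare mass `m > 0` (`κ < 1/8`): `m ^ n ≤ Re det D_W(U, m, 1)`,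
  `n` the matrix size. Proof: `D = (m+4)(1 - x)` with `‖x‖ ≤ 4/(m+4)` in the `ℓ²` operator norm, so
  `‖D⁻¹‖ ≤ 1/m` (Neumann series); Hadamard's inequality bounds `|det B| ≤ ‖B‖ⁿ`, hence
  `|det D⁻¹| ≤ m⁻ⁿ` and `|det D| ≥ mⁿ`; the sign is the tree's `fermionDet_wilsonDirac_re_pos`.
* `pow_le_re_det_wilsonDiracAP` — the same for the crux's antiperiodic operator `wilsonDiracAP U m`
  (`12 L⁴` rows for `SU(3)`).

References: E. Seiler, LNP 159 (1982) (positivity domain `κ < 1/8`); I. Montvay, G. Münster,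
*Quantum Fields on a Lattice* (1994) §4.2, §5.1.2. All statements here are proved.
-/

noncomputable section

open MeasureTheory Matrix Complex Finset
open Literature.MathematicalPhysics.QuantumFieldTheory Literature.MathematicalPhysics.QuantumLattice
open Literature.Probability.LatticeModels (TorusSite)
open scoped ComplexConjugate BigOperators ComplexOrder

namespace Summit.QuantumFields.QCD.Theorems.UnquenchedChessboardBoundLine

/-! ## Determinants versus the `ℓ²` operator norm -/

section OpNorm

open scoped Matrix.Norms.L2Operator

variable {n : Type*} [Fintype n] [DecidableEq n]

/-- The `i`-th column of `A` is `A *ᵥ eᵢ`, so its `ℓ²` mass is at most `‖A‖²`. [folklore] -/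
theorem sum_norm_sq_col_le_opNorm_sq (A : Matrix n n ℂ) (i : n) :
    ∑ j, ‖A j i‖ ^ 2 ≤ ‖A‖ ^ 2 := by
  have h := Matrix.l2_opNorm_mulVec A (EuclideanSpace.single i (1 : ℂ))
  rw [EuclideanSpace.single, PiLp.norm_single, norm_one, mul_one] at h
  have hcol : A *ᵥ (WithLp.ofLp (EuclideanSpace.single i (1 : ℂ))) = fun j => A j i := by
    ext j
    simp [Matrix.mulVec, dotProduct]
  have hnorm : ‖(EuclideanSpace.equiv n ℂ).symm (A *ᵥ WithLp.ofLp (EuclideanSpace.single i (1 : ℂ)))‖ ^ 2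
      = ∑ j, ‖A j i‖ ^ 2 := by
    rw [EuclideanSpace.norm_sq_eq]
    refine Finset.sum_congr rfl fun j _ => ?_
    rw [hcol]
    rfl
  rw [← hnorm]
  exact pow_le_pow_left₀ (norm_nonneg _) h 2

/-- **`|det A| ≤ ‖A‖ⁿ`** for the `ℓ²` operator norm (Hadamard's inequality applied to `Aᴴ`,
whose rows are the columns of `A`). [folklore] -/
theorem norm_det_le_opNorm_pow (A : Matrix n n ℂ) :
    ‖A.det‖ ≤ ‖A‖ ^ Fintype.card n := by
  have hH := Literature.Analysis.Matrix.norm_det_sq_le_prod_sum_sq Aᴴ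
  rw [det_conjTranspose, Complex.star_def, Complex.norm_conj] at hH
  have hrow : ∀ i, ∑ j, ‖Aᴴ i j‖ ^ 2 ≤ ‖A‖ ^ 2 := fun i => by
    simp only [conjTranspose_apply, Complex.star_def, Complex.norm_conj]
    exact sum_norm_sq_col_le_opNorm_sq A i
  have h2 : ‖A.det‖ ^ 2 ≤ (‖A‖ ^ Fintype.card n) ^ 2 := by
    calc ‖A.det‖ ^ 2 ≤ ∏ i, ∑ j, ‖Aᴴ i j‖ ^ 2 := hH
      _ ≤ ∏ _i : n, ‖A‖ ^ 2 := Finset.prod_le_prod (fun i _ => by positivity) fun i _ => hrow i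
      _ = (‖A‖ ^ Fintype.card n) ^ 2 := by
          rw [Finset.prod_const, Finset.card_univ, ← pow_mul, mul_comm, pow_mul]
  exact (pow_le_pow_iff_left₀ (norm_nonneg _) (by positivity) two_ne_zero).1 h2

/-- **Quantitative invertibility**: if `‖A⁻¹‖ ≤ K⁻¹` for a unit `A` and `K > 0`, then
`Kⁿ ≤ |det A|`. [folklore] -/
theorem pow_le_norm_det_of_norm_inv_le (A : Matrix n n ℂ) (hA : IsUnit A.det) {K : ℝ} (hK : 0 < K)
    (hinv : ‖A⁻¹‖ ≤ K⁻¹) : K ^ Fintype.card n ≤ ‖A.det‖ := by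
  have hdet : A.det * A⁻¹.det = 1 := by
    rw [← det_mul, mul_nonsing_inv A hA, det_one]
  have hle : ‖A⁻¹.det‖ ≤ K⁻¹ ^ Fintype.card n :=
    (norm_det_le_opNorm_pow A⁻¹).trans (pow_le_pow_left₀ (norm_nonneg _) hinv _)
  have hpos : 0 < K ^ Fintype.card n := pow_pos hK _
  have h1 : 1 ≤ ‖A.det‖ * K⁻¹ ^ Fintype.card n := by
    calc (1 : ℝ) = ‖A.det * A⁻¹.det‖ := by rw [hdet, norm_one]
      _ = ‖A.det‖ * ‖A⁻¹.det‖ := norm_mul _ _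
      _ ≤ ‖A.det‖ * K⁻¹ ^ Fintype.card n := by gcongr
  rw [inv_pow] at h1
  have := mul_le_mul_of_nonneg_right h1 hpos.le
  rwa [one_mul, mul_assoc, inv_mul_cancel₀ hpos.ne', mul_one] at this

end OpNorm

/-! ## The heavy-window floor `mⁿ ≤ Re det D_W(U, m, 1)` -/

section Wilson

open scoped Matrix.Norms.L2Operator

variable {L N : ℕ} [NeZero L] {G : Type*} [Group G] (ρ : G →* Matrix (Fin N) (Fin N) ℂ)

/-- **Neumann bound on the propagator**: for `m > 0`, `‖D_W(U,m,1)⁻¹‖ ≤ 1/m` in the `ℓ²` operator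
norm (`D = (m+4)(1 - x)`, `‖x‖ ≤ 4/(m+4) < 1`, `‖(1-x)⁻¹‖ ≤ (1 - ‖x‖)⁻¹`). [folklore] -/
theorem norm_inv_wilsonDirac_le (hρ : ∀ g, ρ g ∈ Matrix.unitaryGroup (Fin N) ℂ)
    (U : GaugeConfig 4 L G) {m : ℝ} (hm : 0 < m) :
    ‖(wilsonDirac ρ U m 1)⁻¹‖ ≤ m⁻¹ := by
  have hm4 : (0 : ℝ) < m + 4 := by linarith
  set x : Matrix (TorusSite 4 L × Fin N × Fin 4) (TorusSite 4 L × Fin N × Fin 4) ℂ :=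
    ((1 / (m + 4) : ℝ) : ℂ) • ∑ μ, wilsonHop ρ U μ with hx
  have hxnorm : ‖x‖ ≤ 4 / (m + 4) := by
    rw [hx, norm_smul, Complex.norm_real, Real.norm_eq_abs, abs_of_nonneg (by positivity)]
    calc 1 / (m + 4) * ‖∑ μ, wilsonHop ρ U μ‖ ≤ 1 / (m + 4) * 4 := by
          gcongr
          exact l2_opNorm_sum_wilsonHop_le ρ hρ U
      _ = 4 / (m + 4) := by ring
  have hx1 : ‖x‖ < 1 := hxnorm.trans_lt (by rw [div_lt_one hm4]; linarith)
  -- `D = (m+4) • (1 - x)`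
  have hD : wilsonDirac ρ U m 1 = ((m + 4 : ℝ) : ℂ) • (1 - x) := by
    rw [hx, smul_sub, smul_smul, ← Complex.ofReal_mul,
      show (m + 4) * (1 / (m + 4)) = 1 by field_simp, Complex.ofReal_one, one_smul,
      wilsonDirac_eq_sub_sum_wilsonHop ρ hρ]
  -- the unit `1 - x` and its inverse, the geometric series
  set u := Units.oneSub x hx1 with hu
  set ui : Matrix (TorusSite 4 L × Fin N × Fin 4) (TorusSite 4 L × Fin N × Fin 4) ℂ :=
    (u⁻¹ : (Matrix (TorusSite 4 L × Fin N × Fin 4) (TorusSite 4 L × Fin N × Fin 4) ℂ)ˣ).val with hui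
  have hone : ‖(1 : Matrix (TorusSite 4 L × Fin N × Fin 4) (TorusSite 4 L × Fin N × Fin 4) ℂ)‖ ≤ 1 := by
    rw [Matrix.cstar_norm_def, map_one]
    exact ContinuousLinearMap.norm_id_le
  have hinv1 : ‖ui‖ ≤ (1 - ‖x‖)⁻¹ := by
    have h := tsum_geometric_le_of_norm_lt_one x hx1
    have huinv : ui = ∑' k : ℕ, x ^ k := rfl
    rw [huinv]
    linarith
  have hinvle : (1 - ‖x‖)⁻¹ ≤ (m + 4) / m := by
    have h1x : 0 < 1 - ‖x‖ := by linarith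
    rw [inv_le_comm₀ h1x (by positivity)]
    have : 1 - 4 / (m + 4) = m / (m + 4) := by field_simp; ring
    calc ((m + 4) / m)⁻¹ = m / (m + 4) := by rw [inv_div]
      _ = 1 - 4 / (m + 4) := this.symm
      _ ≤ 1 - ‖x‖ := by linarith
  -- `D⁻¹ = (m+4)⁻¹ • u⁻¹`
  have hunit : (1 - x) = (u : Matrix _ _ ℂ) := rfl
  have hc : ((m + 4 : ℝ) : ℂ) ≠ 0 := by exact_mod_cast hm4.ne'
  have hDinv : (wilsonDirac ρ U m 1)⁻¹ = (((m + 4)⁻¹ : ℝ) : ℂ) • ui := by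
    refine Matrix.inv_eq_right_inv ?_
    rw [hD, hunit, hui, smul_mul_smul_comm, Units.mul_inv, ← Complex.ofReal_mul,
      mul_inv_cancel₀ hm4.ne', Complex.ofReal_one, one_smul]
  rw [hDinv, norm_smul, Complex.norm_real, Real.norm_eq_abs, abs_of_nonneg (by positivity)]
  calc (m + 4)⁻¹ * ‖ui‖ ≤ (m + 4)⁻¹ * ((m + 4) / m) := by
        gcongr
        exact hinv1.trans hinvle
    _ = m⁻¹ := by field_simp

/-- **The heavy-window floor, pathwise** (quantitative Seiler positivity domain, `κ < 1/8`): for a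
unitary colour representation, every gauge field on the periodic four-torus and every bare mass
`m > 0`, `mⁿ ≤ Re det D_W(U, m, 1)` with `n` the number of rows. [folklore] -/
theorem pow_le_re_fermionDet_wilsonDirac (hρ : ∀ g, ρ g ∈ Matrix.unitaryGroup (Fin N) ℂ)
    (U : GaugeConfig 4 L G) {m : ℝ} (hm : 0 < m) :
    m ^ Fintype.card (TorusSite 4 L × Fin N × Fin 4) ≤ (fermionDet (wilsonDirac ρ U m 1)).re := by
  have hpos := fermionDet_wilsonDirac_re_pos ρ hρ U hm
  have hreal := fermionDet_wilsonDirac_eq_ofReal_of_mass_pos ρ hρ U m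
  have hnorm : ‖fermionDet (wilsonDirac ρ U m 1)‖ = (fermionDet (wilsonDirac ρ U m 1)).re := by
    rw [hreal, Complex.norm_real, Complex.ofReal_re, Real.norm_eq_abs, abs_of_pos hpos]
  rw [← hnorm]
  have hunit : IsUnit (wilsonDirac ρ U m 1).det := by
    rw [isUnit_iff_ne_zero]
    intro h0
    have : (fermionDet (wilsonDirac ρ U m 1)).re = 0 := by rw [fermionDet, h0, Complex.zero_re]
    linarith
  have hinv : ‖(wilsonDirac ρ U m 1)⁻¹‖ ≤ m⁻¹ := norm_inv_wilsonDirac_le ρ hρ U hm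
  exact pow_le_norm_det_of_norm_inv_le _ hunit hm hinv

end Wilson

/-! ## The crux's antiperiodic operator -/

section AP

variable {L : ℕ} [NeZero L]

/-- The index type of the `SU(3)` Wilson–Dirac matrix on the four-torus has `12 L⁴` elements.
[folklore] -/
theorem card_quarkIndex :
    Fintype.card (TorusSite 4 L × Fin 3 × Fin 4) = 12 * L ^ 4 := by
  simp only [Fintype.card_prod, Fintype.card_fin, TorusSite, Fintype.card_pi, ZMod.card,
    Finset.prod_const, Finset.card_univ]
  ring

/-- **Heavy-window floor for the crux's operator**: for every `SU(3)` gauge field on the four-torus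
and every bare mass `m > 0`, `m^{12 L⁴} ≤ Re det D_AP[U, m]` (the antiperiodic lift `apLift U` is
just another `U(3)` gauge field). [folklore] -/
theorem pow_le_re_det_wilsonDiracAP (U : GaugeConfig 4 L (Matrix.specialUnitaryGroup (Fin 3) ℂ)) {m : ℝ} (hm : 0 < m) :
    m ^ (12 * L ^ 4) ≤ ((wilsonDiracAP U m).det).re := by
  rw [← card_quarkIndex (L := L), wilsonDiracAP_def]
  exact pow_le_re_fermionDet_wilsonDirac _ unitaryFundamentalRep_mem_unitaryGroup _ hm

/-! ### Continuity of the antiperiodic operator in the gauge field -/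

omit [NeZero L] in
/-- The antiperiodic `U(3)` lift depends continuously on the `SU(3)` field (the seam signs are fixed,
edge by edge). [folklore] -/
theorem continuous_apLift :
    Continuous (apLift : GaugeConfig 4 L (Matrix.specialUnitaryGroup (Fin 3) ℂ) →
      GaugeConfig 4 L (Matrix.unitaryGroup (Fin 3) ℂ)) := by
  refine continuous_pi fun e => ?_
  have hincl : Continuous fun U : GaugeConfig 4 L (Matrix.specialUnitaryGroup (Fin 3) ℂ) =>
      (⟨(U e).1, Matrix.specialUnitaryGroup_le_unitaryGroup (U e).2⟩ : Matrix.unitaryGroup (Fin 3) ℂ) :=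
    (continuous_subtype_val.comp (continuous_apply e)).subtype_mk _
  by_cases h : e.1 e.2 = -1
  · simp only [apLift, h, if_true]
    have hneg : Continuous fun V : Matrix.unitaryGroup (Fin 3) ℂ => -V :=
      (continuous_subtype_val.neg).subtype_mk _
    exact hneg.comp hincl
  · simp only [apLift, h, if_false]
    exact hincl

-- adapted from Literature/MathematicalPhysics/QuantumFieldTheory/QCDPhaseQuenched.lean (continuous_wilsonDirac)
omit [NeZero L] in
/-- For a continuous representation the Wilson–Dirac matrix depends continuously on the gauge field
(entries are constants plus finite sums of `ρ(U_e)_{ab}`, `ρ(U_e⁻¹)_{ab}` times fixed spin matrices).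
[folklore] -/
theorem continuous_wilsonDirac' {G : Type*} [Group G] [TopologicalSpace G] [IsTopologicalGroup G]
    {N : ℕ} (ρ : G →* Matrix (Fin N) (Fin N) ℂ) (hρ : Continuous ρ) (m r : ℝ) :
    Continuous fun U : GaugeConfig 4 L G => wilsonDirac ρ U m r := by
  refine continuous_pi fun p => continuous_pi fun q => ?_
  simp only [wilsonDirac, Matrix.of_apply]
  refine continuous_const.sub (continuous_const.mul (continuous_finsetSum _ fun μ _ => ?_))
  refine Continuous.add ?_ ?_
  · split_ifs
    · exact continuous_const.mul ((hρ.comp (continuous_apply _)).matrix_elem _ _)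
    · exact continuous_const
  · split_ifs
    · exact continuous_const.mul ((hρ.comp ((continuous_apply _).inv)).matrix_elem _ _)
    · exact continuous_const

omit [NeZero L] in
/-- `U ↦ D_AP[U, m]` is continuous. [folklore] -/
theorem continuous_wilsonDiracAP (m : ℝ) :
    Continuous fun U : GaugeConfig 4 L (Matrix.specialUnitaryGroup (Fin 3) ℂ) => wilsonDiracAP U m := by
  have hρ : Continuous (unitaryFundamentalRep (Fin 3) ℂ) := continuous_subtype_val
  have h := continuous_wilsonDirac' (L := L) (unitaryFundamentalRep (Fin 3) ℂ) hρ m 1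
  have hfun : (fun U : GaugeConfig 4 L (Matrix.specialUnitaryGroup (Fin 3) ℂ) => wilsonDiracAP U m) =
      (fun V => wilsonDirac (unitaryFundamentalRep (Fin 3) ℂ) V m 1) ∘ apLift := by
    funext U; rfl
  rw [hfun]
  exact h.comp continuous_apLift

/-- `U ↦ det D_AP[U, m]` is continuous, hence measurable. [folklore] -/
theorem continuous_det_wilsonDiracAP (m : ℝ) :
    Continuous fun U : GaugeConfig 4 L (Matrix.specialUnitaryGroup (Fin 3) ℂ) =>
      (wilsonDiracAP U m).det :=
  (continuous_wilsonDiracAP m).matrix_det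

/-- The `SU(3)` Wilson action of the four-torus is continuous in the gauge field. [folklore] -/
-- adapted from Literature/MathematicalPhysics/QuantumFieldTheory/WilsonEnergyConvexity.lean
theorem continuous_wilsonAction_su3 :
    Continuous (wilsonAction (d := 4) (L := L) (G := Matrix.specialUnitaryGroup (Fin 3) ℂ)
      (fundamentalRep (Fin 3))) := by
  unfold wilsonAction
  refine continuous_finsetSum _ fun p _ => ?_
  have h1 : Continuous fun U : GaugeConfig 4 L (Matrix.specialUnitaryGroup (Fin 3) ℂ) =>
      plaquetteHolonomy U p.1 p.2.1.1 p.2.1.2 := by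
    unfold plaquetteHolonomy; fun_prop
  exact continuous_const.sub
    (Complex.continuous_re.comp ((continuous_fundamentalRep (Fin 3)).comp h1).matrix_trace)

/-! ### The heavy-window floor on the signed partition function -/

/-- **The signed-partition-function floor on HEAVY mass windows** (`0 < m_lo`, i.e. `κ < 1/8`): given
the pure-gauge entropy floor `∫ e^{-β S_W} ∏dU ≥ e^{-(a+εβ)L⁴}` (stub `gaugeFloor` of the line), for
every flavour number and window `[m_lo, m_hi]` with `m_lo > 0` there is `a` with
`Re ∫ ∏_f det D_AP[U, m_f] e^{-β S_W(U)} ∏dU ≥ e^{-(a+εβ)L⁴}` for all `β ≥ 0`, all `L` and all masses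
in the window — pathwise, `∏_f det ≥ m_lo^{12 N_f L⁴}`. This is the `m_lo > 0` case of the line's
stub `signedFloor` (the light window `-1 < m_lo ≤ 0` needs the transfer operator). [folklore] -/
theorem signedFloor_heavy
    (hgauge : ∀ ε : ℝ, 0 < ε → ∃ a : ℝ, ∀ β : ℝ, 0 ≤ β → ∀ (L : ℕ) [NeZero L],
      Real.exp (-((a + ε * β) * (L : ℝ) ^ 4)) ≤
        ∫ U, Real.exp (-β * wilsonAction (fundamentalRep (Fin 3)) U)
          ∂(Measure.pi fun _ : Edge 4 L => haarProbability (Matrix.specialUnitaryGroup (Fin 3) ℂ)))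
    (Nf : ℕ) (mlo mhi ε : ℝ) (hmlo : 0 < mlo) (hε : 0 < ε) :
    ∃ a : ℝ, ∀ β : ℝ, 0 ≤ β → ∀ (L : ℕ) [NeZero L], Even L → 4 ≤ L → ∀ m : Fin Nf → ℝ,
      (∀ f, mlo ≤ m f ∧ m f ≤ mhi) →
      Real.exp (-((a + ε * β) * (L : ℝ) ^ 4)) ≤
        (∫ U, (∏ f, (wilsonDiracAP U (m f)).det) *
            (Real.exp (-β * wilsonAction (fundamentalRep (Fin 3)) U) : ℂ)
          ∂(Measure.pi fun _ : Edge 4 L => haarProbability (Matrix.specialUnitaryGroup (Fin 3) ℂ))).re := by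
  obtain ⟨a₀, ha₀⟩ := hgauge ε hε
  -- `κ ≥ 0` with `e^{-κ} ≤ m_lo`
  set κ : ℝ := max 0 (-Real.log mlo) with hκ
  have hκ0 : 0 ≤ κ := le_max_left _ _
  have hexpκ : Real.exp (-κ) ≤ mlo := by
    by_cases h1 : 1 ≤ mlo
    · have : κ = 0 := by
        rw [hκ, max_eq_left]
        rw [neg_nonpos]
        exact Real.log_nonneg h1
      rw [this, neg_zero, Real.exp_zero]
      exact h1
    · have : κ = -Real.log mlo := by
        rw [hκ, max_eq_right]
        rw [le_neg, neg_zero]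
        exact Real.log_nonpos hmlo.le (le_of_not_ge h1)
      rw [this, neg_neg, Real.exp_log hmlo]
  refine ⟨a₀ + 12 * Nf * κ, fun β hβ L _ _hL _h4 m hm => ?_⟩
  have hgL := ha₀ β hβ L
  set π : Measure (GaugeConfig 4 L (Matrix.specialUnitaryGroup (Fin 3) ℂ)) :=
    Measure.pi fun _ : Edge 4 L => haarProbability (Matrix.specialUnitaryGroup (Fin 3) ℂ) with hπ
  -- the gauge integrand is integrable (its integral is positive)
  have hgint : Integrable (fun U => Real.exp (-β * wilsonAction (fundamentalRep (Fin 3)) U)) π := by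
    by_contra h
    rw [integral_undef h] at hgL
    exact absurd hgL (not_le.2 (Real.exp_pos _))
  -- the fermionic integrand is real: rewrite the complex integral as a real one
  set g : GaugeConfig 4 L (Matrix.specialUnitaryGroup (Fin 3) ℂ) → ℝ :=
    fun U => (∏ f, ((wilsonDiracAP U (m f)).det).re) *
      Real.exp (-β * wilsonAction (fundamentalRep (Fin 3)) U) with hg
  have hreal : ∀ (U : GaugeConfig 4 L (Matrix.specialUnitaryGroup (Fin 3) ℂ)) (x : ℝ),
      (wilsonDiracAP U x).det = ((((wilsonDiracAP U x).det).re : ℝ) : ℂ) :=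
    fun U x => Complex.ext (by simp) (by simpa using fermionDet_wilsonDiracAP_im U x)
  have hintegrand : ∀ U, (∏ f, (wilsonDiracAP U (m f)).det) *
      (Real.exp (-β * wilsonAction (fundamentalRep (Fin 3)) U) : ℂ) = ((g U : ℝ) : ℂ) := by
    intro U
    rw [hg, Complex.ofReal_mul, Complex.ofReal_prod]
    congr 1
    exact Finset.prod_congr rfl fun f _ => hreal U (m f)
  rw [integral_congr_ae (ae_of_all _ hintegrand), integral_complex_ofReal, Complex.ofReal_re]
  -- pathwise lower bound on `g`
  have hmpos : ∀ f, 0 < m f := fun f => hmlo.trans_le (hm f).1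
  have hdetge : ∀ U f, Real.exp (-κ) ^ (12 * L ^ 4) ≤ ((wilsonDiracAP U (m f)).det).re := fun U f =>
    (pow_le_pow_left₀ (Real.exp_pos _).le (hexpκ.trans (hm f).1) _).trans
      (pow_le_re_det_wilsonDiracAP U (hmpos f))
  have hprodge : ∀ U, Real.exp (-(12 * Nf * κ * (L : ℝ) ^ 4)) ≤
      ∏ f, ((wilsonDiracAP U (m f)).det).re := fun U => by
    calc Real.exp (-(12 * Nf * κ * (L : ℝ) ^ 4))
        = ∏ _f : Fin Nf, Real.exp (-κ) ^ (12 * L ^ 4) := by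
          rw [Finset.prod_const, Finset.card_univ, Fintype.card_fin, ← Real.exp_nat_mul,
            ← Real.exp_nat_mul]
          congr 1
          push_cast
          ring
      _ ≤ ∏ f, ((wilsonDiracAP U (m f)).det).re :=
          Finset.prod_le_prod (fun f _ => by positivity) fun f _ => hdetge U f
  have hglow : ∀ U, Real.exp (-(12 * Nf * κ * (L : ℝ) ^ 4)) *
      Real.exp (-β * wilsonAction (fundamentalRep (Fin 3)) U) ≤ g U := fun U =>
    mul_le_mul_of_nonneg_right (hprodge U) (Real.exp_pos _).le
  -- `g` is integrable: continuous on a compact probability space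
  have hgcont : Continuous g := by
    refine Continuous.mul (continuous_finsetProd _ fun f _ => ?_) ?_
    · exact Complex.continuous_re.comp (continuous_det_wilsonDiracAP (m f))
    · exact ((continuous_wilsonAction_su3 (L := L)).const_mul (-β)).rexp
  have hgi : Integrable g π := by
    -- second countability of `SU(3)` (a subspace of `M₃(ℂ) = Fin 3 → Fin 3 → ℂ`), so that continuous
    -- functions on the countable product of links are measurable
    haveI : SecondCountableTopology (Matrix (Fin 3) (Fin 3) ℂ) :=
      inferInstanceAs (SecondCountableTopology (Fin 3 → Fin 3 → ℂ))
    haveI : SecondCountableTopology (Matrix.specialUnitaryGroup (Fin 3) ℂ) :=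
      Topology.IsEmbedding.subtypeVal.secondCountableTopology
    obtain ⟨U₀, -, hU₀⟩ := (isCompact_univ (X := GaugeConfig 4 L (Matrix.specialUnitaryGroup (Fin 3) ℂ))).exists_isMaxOn
      Set.univ_nonempty hgcont.norm.continuousOn
    exact Integrable.of_bound hgcont.measurable.aestronglyMeasurable ‖g U₀‖
      (Filter.Eventually.of_forall fun U => hU₀ (Set.mem_univ U))
  -- assemble
  calc Real.exp (-((a₀ + 12 * Nf * κ + ε * β) * (L : ℝ) ^ 4))
      = Real.exp (-(12 * Nf * κ * (L : ℝ) ^ 4)) * Real.exp (-((a₀ + ε * β) * (L : ℝ) ^ 4)) := by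
        rw [← Real.exp_add]
        congr 1
        ring
    _ ≤ Real.exp (-(12 * Nf * κ * (L : ℝ) ^ 4)) *
          ∫ U, Real.exp (-β * wilsonAction (fundamentalRep (Fin 3)) U) ∂π := by
        gcongr
    _ = ∫ U, Real.exp (-(12 * Nf * κ * (L : ℝ) ^ 4)) *
          Real.exp (-β * wilsonAction (fundamentalRep (Fin 3)) U) ∂π := (integral_const_mul _ _).symm
    _ ≤ ∫ U, g U ∂π := integral_mono (hgint.const_mul _) hgi hglow

end AP

end Summit.QuantumFields.QCD.Theorems.UnquenchedChessboardBoundLine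

end
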